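import Summits.CriticalPhenomena.PercolationContinuityZ3.Theorems.Transplant.FKConnectivityAllQAntipodalRootFormSpine
import Summits.CriticalPhenomena.PercolationContinuityZ3.Theorems.Transplant.FKConnectivityAllQAntipodalRootFormAttachSPar
import Summits.CriticalPhenomena.PercolationContinuityZ3.Theorems.Transplant.FKConnectivityAllQAntipodalRootFormAttachPFacts

/-!
# Connectivity correlation inequalities for `φ_{w,q}`, every `q > 0` — ROOT-FORM CALCULUS, file 61x: REAL special-free boxes and the real
# parallel / series attachments (`A ∥ 𝓔`, `B · 𝓔` for two-terminal series–parallel `A`, `B`)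

Support file (`--supports stmt-CriticalPhenomena-4575`), FK sub-lane `prim-bschramm-fk-2` (gen 29); builds on p205010 (kernel theorem,
internal audit signed; external expert review pending).  Definitions `realSDat0`, `realSBox` (table of a real special-free box); no named facts,
no sorries; standard axioms.  Memo FROM-fk-2-g28-ROOT-FORM.md §3–§4; FK-Q2 §38.

* `realSBox_thmU` — Theorem U at every exact level for a real two-terminal series–parallel box (`FK.apUpcCLW_nonneg_of_isTTSP` with the level
  weight `1{· = K}`), in the `kd` form consumed by files 61u–61w;
* `acomb_realSDat0`, `scomb_realSDat0` — the parallel / series gluing laws (`FK.apExpC_parallel`, `FK.apExpC_series`,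
  `FK.reachable_union_parallel/series`) at the level of pattern data: the real environment of `A ∥ 𝓔` / `B · 𝓔` is `attP` / `attS` of the real
  data, every level lowered by `2|V|`;
* `realEnv_attP_facts`, `realEnv_attS_facts` — hence the five facts of the word theorem pass from the real environment of `𝓔` to those of
  `A ∥ 𝓔` and `B · 𝓔` (abstract `attP_facts` / `attS_facts` + the transfer of file 61q along `(α, β) ↦ α ∪ β`).
[cite: Grimmett2006, §1.4 eq. (1.20) (p. 15); §3.8 Thm. (3.90) (pp. 61–62)] [cite: Wagner2006, Thm. 5.8(d), §5.3]
-/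

noncomputable section

namespace Summit.CriticalPhenomena.PercolationContinuityZ3.Theorems

namespace FK

namespace RootForm

open SimpleGraph Finset Literature.Probability.LatticeModels Literature.Probability.Percolation
open scoped Classical

variable {V : Type*} [Fintype V]

/-- Datum of a real special-free box (cell `M` free, `C` contracted, poles `a, b`) at the replica-1 set `X`: level and the two pole bits.
(memo FROM-fk-2-g28-ROOT-FORM §3) -/
def realSDat0 (M C : Finset (Sym2 V)) (a b : V) (X : Finset (Sym2 V)) : Base.SDat :=
  ⟨(apExpC M C X : ℤ), reachB (X ∪ C) a b, reachB (M \ X ∪ C) a b⟩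

/-- The table of a real special-free box over `↥M.powerset`. (memo FROM-fk-2-g28-ROOT-FORM §3) -/
def realSBox (M C : Finset (Sym2 V)) (a b : V) (β : ↥M.powerset) : Base.SDat := realSDat0 M C a b β.1

section ThmU

variable {A M C : Finset (Sym2 V)} {a b : V}

/-- **Theorem U at every exact level for a real box** (`kd` form): `Σ_β h(β)·[L(β) = K]·(kd₁₀ − kd₀₁)(β) ≥ 0` for monotone `h`.
[cite: Grimmett2006, §3.8 Thm. (3.90) (pp. 61–62)] [cite: Wagner2006, Thm. 5.8(d), §5.3] -/
theorem realSBox_thmU (hA : IsTTSP A a b) (hM : M ⊆ A) (hC : C ⊆ A) (h : ↥M.powerset → ℝ) (mh : Monotone h) (_nh : ∀ β, 0 ≤ h β) (K : ℤ) :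
    0 ≤ ∑ β, h β * ((if (realSBox M C a b β).L = K then (1 : ℝ) else 0) * (kd (realSBox M C a b β) true false - kd (realSBox M C a b β) false true)) := by
  have key := apUpcCLW_nonneg_of_isTTSP hA M C hM hC (fun n => if (n : ℤ) = K then 1 else 0) (fun n => by split_ifs <;> norm_num)
    _ (extWeight_mono mh)
  unfold apUpcCLW at key
  rw [← Finset.sum_coe_sort] at key
  refine key.trans_eq (Finset.sum_congr rfl fun β _ => ?_)
  dsimp only
  rw [extWeight_apply h β]
  simp only [realSBox, realSDat0, kd, reachB, apConn, decide_eq_true_eq, decide_eq_false_iff_not]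
  by_cases h1 : (openGraph (↑(β.1 ∪ C) : BondConfig V)).Reachable a b <;>
    by_cases h2 : (openGraph (↑(M \ β.1 ∪ C) : BondConfig V)).Reachable a b <;>
    simp only [h1, h2, if_true, if_false, not_true, not_false_iff, and_true, and_false] <;> ring

end ThmU

section Gluing

variable {A F MA CA M C : Finset (Sym2 V)} {a c d m b uy vy uz vz : V}

/-- **Parallel gluing of a special-free box with a two-special part, at the level of data.** [cite: Grimmett2006, §3.8 (pp. 61–62)] -/
theorem acomb_realSDat0 (hA : IsTTSP A c d) (hd : Disjoint A F)
    (hV : ∀ w : V, (∃ e ∈ A, w ∈ e) → (∃ e ∈ F, w ∈ e) → w = c ∨ w = d)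
    (hMA : MA ⊆ A) (hCA : CA ⊆ A) (hM : insert s(uy, vy) (insert s(uz, vz) M) ⊆ F) (hC : C ⊆ F)
    {XA X : Finset (Sym2 V)} (hXA : XA ⊆ MA) (hX : X ⊆ insert s(uy, vy) (insert s(uz, vz) M)) {Y : Finset (Sym2 V)} (hY : Y = XA ∪ X) :
    acomb (realSDat0 MA CA c d XA) (realPDat M C c d s(uy, vy) s(uz, vz) X) =
      ⟨(realPDat (MA ∪ M) (CA ∪ C) c d s(uy, vy) s(uz, vz) Y).lam + 2 * Fintype.card V,
        (realPDat (MA ∪ M) (CA ∪ C) c d s(uy, vy) s(uz, vz) Y).k1, (realPDat (MA ∪ M) (CA ∪ C) c d s(uy, vy) s(uz, vz) Y).k2⟩ := by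
  subst hY
  have g₁ : ∀ e ∈ (↑A : Set (Sym2 V)), ∀ w ∈ e, w ∈ {w : V | ∃ e ∈ A, w ∈ e} := fun e he w hw => ⟨e, he, hw⟩
  have g₂ : ∀ e ∈ (↑F : Set (Sym2 V)), ∀ w ∈ e, w ∈ {w : V | ∃ e ∈ F, w ∈ e} := fun e he w hw => ⟨e, he, hw⟩
  have gS : {w : V | ∃ e ∈ A, w ∈ e} ∩ {w : V | ∃ e ∈ F, w ∈ e} ⊆ ({c, d} : Set V) := by
    intro w hw
    rcases hV w hw.1 hw.2 with h | h
    · exact Or.inl h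
    · exact Or.inr h
  have hMU : MA ∪ insert s(uy, vy) (insert s(uz, vz) M) = insert s(uy, vy) (insert s(uz, vz) (MA ∪ M)) := by
    rw [Finset.union_insert, Finset.union_insert]
  have k := apExpC_parallel hd g₁ g₂ gS hA.ne hMA hM hCA hC hXA hX
  have r1 := reachable_union_parallel g₁ g₂ gS (Finset.union_subset (hXA.trans hMA) hCA) (Finset.union_subset (hX.trans hM) hC)
  have r2 := reachable_union_parallel g₁ g₂ gS (γ₁ := MA \ XA ∪ CA) (γ₂ := insert s(uy, vy) (insert s(uz, vz) M) \ X ∪ C)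
    (Finset.union_subset (Finset.sdiff_subset.trans hMA) hCA) (Finset.union_subset (Finset.sdiff_subset.trans hM) hC)
  have hdM : Disjoint MA (insert s(uy, vy) (insert s(uz, vz) M)) := Finset.disjoint_of_subset_left hMA (Finset.disjoint_of_subset_right hM hd)
  have e1 : XA ∪ X ∪ (CA ∪ C) = XA ∪ CA ∪ (X ∪ C) := Finset.union_union_union_comm _ _ _ _
  have e2 : insert s(uy, vy) (insert s(uz, vz) (MA ∪ M)) \ (XA ∪ X) ∪ (CA ∪ C) =
      MA \ XA ∪ CA ∪ (insert s(uy, vy) (insert s(uz, vz) M) \ X ∪ C) := by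
    rw [← hMU, union_sdiff_union hdM hXA hX, Finset.union_union_union_comm]
  rw [hMU] at k
  simp only [acomb, PDat.mk.injEq]
  refine ⟨?_, ?_, ?_⟩
  · have k' := congrArg (Nat.cast : ℕ → ℤ) k
    simp only [Nat.cast_add, Nat.cast_mul, Nat.cast_ofNat, Nat.cast_ite, Nat.cast_one, Nat.cast_zero] at k'
    simp only [realPDat, realSDat0, reachB, bit]
    by_cases h1 : (openGraph (↑(XA ∪ CA) : BondConfig V)).Reachable c d <;>
      by_cases h2 : (openGraph (↑(X ∪ C) : BondConfig V)).Reachable c d <;>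
      by_cases h3 : (openGraph (↑(MA \ XA ∪ CA) : BondConfig V)).Reachable c d <;>
      by_cases h4 : (openGraph (↑(insert s(uy, vy) (insert s(uz, vz) M) \ X ∪ C) : BondConfig V)).Reachable c d <;>
      simp only [h1, h2, h3, h4, and_self, and_true, and_false, if_true, if_false, decide_true, decide_false, Bool.and_self,
        Bool.and_true, Bool.and_false, Bool.false_eq_true] at k' ⊢ <;>
      linarith
  · simp only [realPDat, realSDat0, reachB, e1]
    rw [Bool.eq_iff_iff]
    simp only [Bool.or_eq_true, decide_eq_true_eq]
    exact r1.symm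
  · simp only [realPDat, realSDat0, reachB, e2]
    rw [Bool.eq_iff_iff]
    simp only [Bool.or_eq_true, decide_eq_true_eq]
    exact r2.symm

/-- **Series gluing of a special-free box (poles `a, m`) with a two-special part (poles `m, b`), at the level of data.**
[cite: Grimmett2006, §3.8 (pp. 61–62)] -/
theorem scomb_realSDat0 (hd : Disjoint A F)
    (hV : ∀ w : V, (∃ e ∈ A, w ∈ e) → (∃ e ∈ F, w ∈ e) → w = m) (haF : ∀ e ∈ F, a ∉ e) (hbA : ∀ e ∈ A, b ∉ e)
    (ham : a ≠ m) (hbm : b ≠ m) (hab : a ≠ b)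
    (hMA : MA ⊆ A) (hCA : CA ⊆ A) (hM : insert s(uy, vy) (insert s(uz, vz) M) ⊆ F) (hC : C ⊆ F)
    {XA X : Finset (Sym2 V)} (hXA : XA ⊆ MA) (hX : X ⊆ insert s(uy, vy) (insert s(uz, vz) M)) {Y : Finset (Sym2 V)} (hY : Y = XA ∪ X) :
    scomb (realSDat0 MA CA a m XA) (realPDat M C m b s(uy, vy) s(uz, vz) X) =
      ⟨(realPDat (MA ∪ M) (CA ∪ C) a b s(uy, vy) s(uz, vz) Y).lam + 2 * Fintype.card V,
        (realPDat (MA ∪ M) (CA ∪ C) a b s(uy, vy) s(uz, vz) Y).k1, (realPDat (MA ∪ M) (CA ∪ C) a b s(uy, vy) s(uz, vz) Y).k2⟩ := by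
  subst hY
  have g₁ : ∀ e ∈ (↑A : Set (Sym2 V)), ∀ w ∈ e, w ∈ {w : V | ∃ e ∈ A, w ∈ e} := fun e he w hw => ⟨e, he, hw⟩
  have g₂ : ∀ e ∈ (↑F : Set (Sym2 V)), ∀ w ∈ e, w ∈ {w : V | ∃ e ∈ F, w ∈ e} := fun e he w hw => ⟨e, he, hw⟩
  have gS : {w : V | ∃ e ∈ A, w ∈ e} ∩ {w : V | ∃ e ∈ F, w ∈ e} ⊆ ({m} : Set V) := fun w hw => hV w hw.1 hw.2
  have haV : a ∉ {w : V | ∃ e ∈ F, w ∈ e} := fun ⟨e, he, hae⟩ => haF e he hae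
  have hbV : b ∉ {w : V | ∃ e ∈ A, w ∈ e} := fun ⟨e, he, hbe⟩ => hbA e he hbe
  have hMU : MA ∪ insert s(uy, vy) (insert s(uz, vz) M) = insert s(uy, vy) (insert s(uz, vz) (MA ∪ M)) := by
    rw [Finset.union_insert, Finset.union_insert]
  have k := apExpC_series hd g₁ g₂ gS hMA hM hCA hC hXA hX
  have r1 := reachable_union_series g₁ g₂ gS haV hbV ham hbm hab (Finset.union_subset (hXA.trans hMA) hCA)
    (Finset.union_subset (hX.trans hM) hC)
  have r2 := reachable_union_series g₁ g₂ gS haV hbV ham hbm hab (γ₁ := MA \ XA ∪ CA)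
    (γ₂ := insert s(uy, vy) (insert s(uz, vz) M) \ X ∪ C)
    (Finset.union_subset (Finset.sdiff_subset.trans hMA) hCA) (Finset.union_subset (Finset.sdiff_subset.trans hM) hC)
  have hdM : Disjoint MA (insert s(uy, vy) (insert s(uz, vz) M)) := Finset.disjoint_of_subset_left hMA (Finset.disjoint_of_subset_right hM hd)
  have e1 : XA ∪ X ∪ (CA ∪ C) = XA ∪ CA ∪ (X ∪ C) := Finset.union_union_union_comm _ _ _ _
  have e2 : insert s(uy, vy) (insert s(uz, vz) (MA ∪ M)) \ (XA ∪ X) ∪ (CA ∪ C) =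
      MA \ XA ∪ CA ∪ (insert s(uy, vy) (insert s(uz, vz) M) \ X ∪ C) := by
    rw [← hMU, union_sdiff_union hdM hXA hX, Finset.union_union_union_comm]
  rw [hMU] at k
  simp only [scomb, PDat.mk.injEq]
  refine ⟨?_, ?_, ?_⟩
  · have k' := congrArg (Nat.cast : ℕ → ℤ) k
    simp only [Nat.cast_add, Nat.cast_mul, Nat.cast_ofNat] at k'
    simp only [realPDat, realSDat0]
    linarith
  · simp only [realPDat, realSDat0, reachB, e1]
    rw [Bool.eq_iff_iff]
    simp only [Bool.and_eq_true, decide_eq_true_eq]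
    exact r1.symm
  · simp only [realPDat, realSDat0, reachB, e2]
    rw [Bool.eq_iff_iff]
    simp only [Bool.and_eq_true, decide_eq_true_eq]
    exact r2.symm

end Gluing

section Transfers

variable {A F MA CA M C : Finset (Sym2 V)} {a m b uy vy uz vz : V}

/-- **The five facts pass from the real environment of `𝓔` to that of `A ∥ 𝓔`** (`A` two-terminal series–parallel between the poles,
edge-disjoint from the part `F ⊇ M ∪ C ∪ {y,z}` carrying the specials, vertex sets meeting only in the poles).
[cite: Grimmett2006, §3.8 Thm. (3.90) (pp. 61–62)] [cite: Wagner2006, Thm. 5.8(d), §5.3] -/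
theorem realEnv_attP_facts (hA : IsTTSP A a b) (hd : Disjoint A F)
    (hV : ∀ w : V, (∃ e ∈ A, w ∈ e) → (∃ e ∈ F, w ∈ e) → w = a ∨ w = b)
    (hMA : MA ⊆ A) (hCA : CA ⊆ A) (hM : insert s(uy, vy) (insert s(uz, vz) M) ⊆ F) (hC : C ⊆ F)
    (h5 : (∀ h0 h1 : ↥(M).powerset → ℝ, Monotone h0 → Monotone h1 → (∀ γ, 0 ≤ h0 γ) → (∀ γ, h0 γ ≤ h1 γ) → ∀ J : ℤ,
        0 ≤ Mt (realEnv (M) (C) a b s(uy, vy) s(uz, vz)) h0 h1 J)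
      ∧ (∀ h0 h1 : Bool × ↥(M).powerset → ℝ, Monotone h0 → Monotone h1 → (∀ p, 0 ≤ h0 p) → (∀ p, h0 p ≤ h1 p) → ∀ J : ℤ,
        0 ≤ Mt (parE (realEnv (M) (C) a b s(uy, vy) s(uz, vz))) h0 h1 J)
      ∧ (∀ h : ↥(M).powerset → ℝ, Monotone h → (∀ γ, 0 ≤ h γ) → ∀ J : ℤ,
        0 ≤ ∑ γ, h γ * (realEnv (M) (C) a b s(uy, vy) s(uz, vz) γ).andDel J)
      ∧ (∀ h : ↥(M).powerset → ℝ, Monotone h → (∀ γ, 0 ≤ h γ) → ∀ J : ℤ,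
        0 ≤ ∑ γ, h γ * (realEnv (M) (C) a b s(uy, vy) s(uz, vz) γ).andCon J)
      ∧ (∀ h0 h1 : ↥(M).powerset → ℝ, Monotone h0 → Monotone h1 → (∀ γ, 0 ≤ h0 γ) → (∀ γ, h0 γ ≤ h1 γ) → ∀ J : ℤ,
          0 ≤ ∑ γ, (h1 γ * (realEnv (M) (C) a b s(uy, vy) s(uz, vz) γ).andE1 J +
            h0 γ * (realEnv (M) (C) a b s(uy, vy) s(uz, vz) γ).andE2 J))) :
    (∀ h0 h1 : ↥(MA ∪ M).powerset → ℝ, Monotone h0 → Monotone h1 → (∀ γ, 0 ≤ h0 γ) → (∀ γ, h0 γ ≤ h1 γ) → ∀ J : ℤ,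
        0 ≤ Mt (realEnv (MA ∪ M) (CA ∪ C) a b s(uy, vy) s(uz, vz)) h0 h1 J)
      ∧ (∀ h0 h1 : Bool × ↥(MA ∪ M).powerset → ℝ, Monotone h0 → Monotone h1 → (∀ p, 0 ≤ h0 p) → (∀ p, h0 p ≤ h1 p) → ∀ J : ℤ,
        0 ≤ Mt (parE (realEnv (MA ∪ M) (CA ∪ C) a b s(uy, vy) s(uz, vz))) h0 h1 J)
      ∧ (∀ h : ↥(MA ∪ M).powerset → ℝ, Monotone h → (∀ γ, 0 ≤ h γ) → ∀ J : ℤ,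
        0 ≤ ∑ γ, h γ * (realEnv (MA ∪ M) (CA ∪ C) a b s(uy, vy) s(uz, vz) γ).andDel J)
      ∧ (∀ h : ↥(MA ∪ M).powerset → ℝ, Monotone h → (∀ γ, 0 ≤ h γ) → ∀ J : ℤ,
        0 ≤ ∑ γ, h γ * (realEnv (MA ∪ M) (CA ∪ C) a b s(uy, vy) s(uz, vz) γ).andCon J)
      ∧ (∀ h0 h1 : ↥(MA ∪ M).powerset → ℝ, Monotone h0 → Monotone h1 → (∀ γ, 0 ≤ h0 γ) → (∀ γ, h0 γ ≤ h1 γ) → ∀ J : ℤ,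
          0 ≤ ∑ γ, (h1 γ * (realEnv (MA ∪ M) (CA ∪ C) a b s(uy, vy) s(uz, vz) γ).andE1 J +
            h0 γ * (realEnv (MA ∪ M) (CA ∪ C) a b s(uy, vy) s(uz, vz) γ).andE2 J)) := by
  have hdM : Disjoint MA M := Finset.disjoint_of_subset_left hMA (Finset.disjoint_of_subset_right
    (((Finset.subset_insert _ _).trans (Finset.subset_insert _ _)).trans hM) hd)
  let φ : ↥MA.powerset × ↥M.powerset ≃ ↥(MA ∪ M).powerset :=
    { toFun := fun p => ⟨p.1.1 ∪ p.2.1, Finset.mem_powerset.2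
        (Finset.union_subset_union (Finset.mem_powerset.1 p.1.2) (Finset.mem_powerset.1 p.2.2))⟩
      invFun := fun δ => (⟨δ.1 ∩ MA, Finset.mem_powerset.2 Finset.inter_subset_right⟩,
        ⟨δ.1 ∩ M, Finset.mem_powerset.2 Finset.inter_subset_right⟩)
      left_inv := fun p => by
        obtain ⟨⟨X, hX⟩, ⟨Y, hY⟩⟩ := p
        have hX' := Finset.mem_powerset.1 hX; have hY' := Finset.mem_powerset.1 hY
        refine Prod.ext (Subtype.ext ?_) (Subtype.ext ?_)
        · show (X ∪ Y) ∩ MA = X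
          rw [Finset.union_inter_distrib_right, Finset.inter_eq_left.2 hX',
            Finset.disjoint_iff_inter_eq_empty.1 (Finset.disjoint_of_subset_left hY' hdM.symm), Finset.union_empty]
        · show (X ∪ Y) ∩ M = Y
          rw [Finset.union_inter_distrib_right, Finset.inter_eq_left.2 hY',
            Finset.disjoint_iff_inter_eq_empty.1 (Finset.disjoint_of_subset_left hX' hdM), Finset.empty_union]
      right_inv := fun δ => Subtype.ext (by
        show δ.1 ∩ MA ∪ δ.1 ∩ M = δ.1
        rw [← Finset.inter_union_distrib_left, Finset.inter_eq_left.2 (Finset.mem_powerset.1 δ.2)]) }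
  have hφ : Monotone φ := fun p q hpq => show (φ p).1 ⊆ (φ q).1 from Finset.union_subset_union hpq.1 hpq.2
  have hd' : ∀ p : ↥MA.powerset × ↥M.powerset, realEnv (MA ∪ M) (CA ∪ C) a b s(uy, vy) s(uz, vz) (φ p) =
      ⟨⟨(attP (realSBox MA CA a b) (realEnv M C a b s(uy, vy) s(uz, vz)) p).d0.lam + (-(2 * (Fintype.card V : ℤ))), (attP (realSBox MA CA a b) (realEnv M C a b s(uy, vy) s(uz, vz)) p).d0.k1, (attP (realSBox MA CA a b) (realEnv M C a b s(uy, vy) s(uz, vz)) p).d0.k2⟩,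
        ⟨(attP (realSBox MA CA a b) (realEnv M C a b s(uy, vy) s(uz, vz)) p).dy.lam + (-(2 * (Fintype.card V : ℤ))), (attP (realSBox MA CA a b) (realEnv M C a b s(uy, vy) s(uz, vz)) p).dy.k1, (attP (realSBox MA CA a b) (realEnv M C a b s(uy, vy) s(uz, vz)) p).dy.k2⟩,
        ⟨(attP (realSBox MA CA a b) (realEnv M C a b s(uy, vy) s(uz, vz)) p).dz.lam + (-(2 * (Fintype.card V : ℤ))), (attP (realSBox MA CA a b) (realEnv M C a b s(uy, vy) s(uz, vz)) p).dz.k1, (attP (realSBox MA CA a b) (realEnv M C a b s(uy, vy) s(uz, vz)) p).dz.k2⟩,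
        ⟨(attP (realSBox MA CA a b) (realEnv M C a b s(uy, vy) s(uz, vz)) p).dyz.lam + (-(2 * (Fintype.card V : ℤ))), (attP (realSBox MA CA a b) (realEnv M C a b s(uy, vy) s(uz, vz)) p).dyz.k1, (attP (realSBox MA CA a b) (realEnv M C a b s(uy, vy) s(uz, vz)) p).dyz.k2⟩⟩ := by
    rintro ⟨α, β⟩
    have hα : α.1 ⊆ MA := Finset.mem_powerset.1 α.2
    have hX : β.1 ⊆ M := Finset.mem_powerset.1 β.2
    have p0 : β.1 ⊆ insert s(uy, vy) (insert s(uz, vz) M) := hX.trans ((Finset.subset_insert _ _).trans (Finset.subset_insert _ _))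
    have py : insert s(uy, vy) β.1 ⊆ insert s(uy, vy) (insert s(uz, vz) M) := Finset.insert_subset_insert _ (hX.trans (Finset.subset_insert _ _))
    have pz : insert s(uz, vz) β.1 ⊆ insert s(uy, vy) (insert s(uz, vz) M) :=
      (Finset.insert_subset_insert _ hX).trans (Finset.subset_insert _ _)
    have pyz : insert s(uy, vy) (insert s(uz, vz) β.1) ⊆ insert s(uy, vy) (insert s(uz, vz) M) :=
      Finset.insert_subset_insert _ (Finset.insert_subset_insert _ hX)
    have e0 := PDat.eq_of_addLam (acomb_realSDat0 hA hd hV hMA hCA hM hC hα p0 (rfl : α.1 ∪ β.1 = _))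
    have ey := PDat.eq_of_addLam (acomb_realSDat0 hA hd hV hMA hCA hM hC hα py (Finset.union_insert _ _ _).symm)
    have ez := PDat.eq_of_addLam (acomb_realSDat0 hA hd hV hMA hCA hM hC hα pz (Finset.union_insert _ _ _).symm)
    have eyz := PDat.eq_of_addLam (acomb_realSDat0 hA hd hV hMA hCA hM hC hα pyz
      (by rw [Finset.union_insert, Finset.union_insert]))
    show (⟨realPDat _ _ a b _ _ (α.1 ∪ β.1), realPDat _ _ a b _ _ (insert s(uy, vy) (α.1 ∪ β.1)),
      realPDat _ _ a b _ _ (insert s(uz, vz) (α.1 ∪ β.1)), realPDat _ _ a b _ _ (insert s(uy, vy) (insert s(uz, vz) (α.1 ∪ β.1)))⟩ : EDat) = _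
    rw [e0, ey, ez, eyz]
    rfl
  exact transfer_facts hφ hd' (attP_facts (realSBox MA CA a b) (realEnv M C a b s(uy, vy) s(uz, vz)) (realSBox_thmU hA hMA hCA) h5)

/-- **The five facts pass from the real environment of `𝓔` (poles `m, b`) to that of `B · 𝓔`** (poles `a, b`; `B` two-terminal
series–parallel between `a, m`, edge-disjoint from the part `F` carrying the specials, vertex sets meeting only in `m`, `a` off `F`, `b` off `B`).
[cite: Grimmett2006, §3.8 Thm. (3.90) (pp. 61–62)] [cite: Wagner2006, Thm. 5.8(d), §5.3] -/
theorem realEnv_attS_facts (hA : IsTTSP A a m) (hd : Disjoint A F)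
    (hV : ∀ w : V, (∃ e ∈ A, w ∈ e) → (∃ e ∈ F, w ∈ e) → w = m) (haF : ∀ e ∈ F, a ∉ e) (hbA : ∀ e ∈ A, b ∉ e)
    (ham : a ≠ m) (hbm : b ≠ m) (hab : a ≠ b)
    (hMA : MA ⊆ A) (hCA : CA ⊆ A) (hM : insert s(uy, vy) (insert s(uz, vz) M) ⊆ F) (hC : C ⊆ F)
    (h5 : (∀ h0 h1 : ↥(M).powerset → ℝ, Monotone h0 → Monotone h1 → (∀ γ, 0 ≤ h0 γ) → (∀ γ, h0 γ ≤ h1 γ) → ∀ J : ℤ,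
        0 ≤ Mt (realEnv (M) (C) m b s(uy, vy) s(uz, vz)) h0 h1 J)
      ∧ (∀ h0 h1 : Bool × ↥(M).powerset → ℝ, Monotone h0 → Monotone h1 → (∀ p, 0 ≤ h0 p) → (∀ p, h0 p ≤ h1 p) → ∀ J : ℤ,
        0 ≤ Mt (parE (realEnv (M) (C) m b s(uy, vy) s(uz, vz))) h0 h1 J)
      ∧ (∀ h : ↥(M).powerset → ℝ, Monotone h → (∀ γ, 0 ≤ h γ) → ∀ J : ℤ,
        0 ≤ ∑ γ, h γ * (realEnv (M) (C) m b s(uy, vy) s(uz, vz) γ).andDel J)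
      ∧ (∀ h : ↥(M).powerset → ℝ, Monotone h → (∀ γ, 0 ≤ h γ) → ∀ J : ℤ,
        0 ≤ ∑ γ, h γ * (realEnv (M) (C) m b s(uy, vy) s(uz, vz) γ).andCon J)
      ∧ (∀ h0 h1 : ↥(M).powerset → ℝ, Monotone h0 → Monotone h1 → (∀ γ, 0 ≤ h0 γ) → (∀ γ, h0 γ ≤ h1 γ) → ∀ J : ℤ,
          0 ≤ ∑ γ, (h1 γ * (realEnv (M) (C) m b s(uy, vy) s(uz, vz) γ).andE1 J +
            h0 γ * (realEnv (M) (C) m b s(uy, vy) s(uz, vz) γ).andE2 J))) :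
    (∀ h0 h1 : ↥(MA ∪ M).powerset → ℝ, Monotone h0 → Monotone h1 → (∀ γ, 0 ≤ h0 γ) → (∀ γ, h0 γ ≤ h1 γ) → ∀ J : ℤ,
        0 ≤ Mt (realEnv (MA ∪ M) (CA ∪ C) a b s(uy, vy) s(uz, vz)) h0 h1 J)
      ∧ (∀ h0 h1 : Bool × ↥(MA ∪ M).powerset → ℝ, Monotone h0 → Monotone h1 → (∀ p, 0 ≤ h0 p) → (∀ p, h0 p ≤ h1 p) → ∀ J : ℤ,
        0 ≤ Mt (parE (realEnv (MA ∪ M) (CA ∪ C) a b s(uy, vy) s(uz, vz))) h0 h1 J)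
      ∧ (∀ h : ↥(MA ∪ M).powerset → ℝ, Monotone h → (∀ γ, 0 ≤ h γ) → ∀ J : ℤ,
        0 ≤ ∑ γ, h γ * (realEnv (MA ∪ M) (CA ∪ C) a b s(uy, vy) s(uz, vz) γ).andDel J)
      ∧ (∀ h : ↥(MA ∪ M).powerset → ℝ, Monotone h → (∀ γ, 0 ≤ h γ) → ∀ J : ℤ,
        0 ≤ ∑ γ, h γ * (realEnv (MA ∪ M) (CA ∪ C) a b s(uy, vy) s(uz, vz) γ).andCon J)
      ∧ (∀ h0 h1 : ↥(MA ∪ M).powerset → ℝ, Monotone h0 → Monotone h1 → (∀ γ, 0 ≤ h0 γ) → (∀ γ, h0 γ ≤ h1 γ) → ∀ J : ℤ,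
          0 ≤ ∑ γ, (h1 γ * (realEnv (MA ∪ M) (CA ∪ C) a b s(uy, vy) s(uz, vz) γ).andE1 J +
            h0 γ * (realEnv (MA ∪ M) (CA ∪ C) a b s(uy, vy) s(uz, vz) γ).andE2 J)) := by
  have hdM : Disjoint MA M := Finset.disjoint_of_subset_left hMA (Finset.disjoint_of_subset_right
    (((Finset.subset_insert _ _).trans (Finset.subset_insert _ _)).trans hM) hd)
  let φ : ↥MA.powerset × ↥M.powerset ≃ ↥(MA ∪ M).powerset :=
    { toFun := fun p => ⟨p.1.1 ∪ p.2.1, Finset.mem_powerset.2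
        (Finset.union_subset_union (Finset.mem_powerset.1 p.1.2) (Finset.mem_powerset.1 p.2.2))⟩
      invFun := fun δ => (⟨δ.1 ∩ MA, Finset.mem_powerset.2 Finset.inter_subset_right⟩,
        ⟨δ.1 ∩ M, Finset.mem_powerset.2 Finset.inter_subset_right⟩)
      left_inv := fun p => by
        obtain ⟨⟨X, hX⟩, ⟨Y, hY⟩⟩ := p
        have hX' := Finset.mem_powerset.1 hX; have hY' := Finset.mem_powerset.1 hY
        refine Prod.ext (Subtype.ext ?_) (Subtype.ext ?_)
        · show (X ∪ Y) ∩ MA = X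
          rw [Finset.union_inter_distrib_right, Finset.inter_eq_left.2 hX',
            Finset.disjoint_iff_inter_eq_empty.1 (Finset.disjoint_of_subset_left hY' hdM.symm), Finset.union_empty]
        · show (X ∪ Y) ∩ M = Y
          rw [Finset.union_inter_distrib_right, Finset.inter_eq_left.2 hY',
            Finset.disjoint_iff_inter_eq_empty.1 (Finset.disjoint_of_subset_left hX' hdM), Finset.empty_union]
      right_inv := fun δ => Subtype.ext (by
        show δ.1 ∩ MA ∪ δ.1 ∩ M = δ.1
        rw [← Finset.inter_union_distrib_left, Finset.inter_eq_left.2 (Finset.mem_powerset.1 δ.2)]) }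
  have hφ : Monotone φ := fun p q hpq => show (φ p).1 ⊆ (φ q).1 from Finset.union_subset_union hpq.1 hpq.2
  have hd' : ∀ p : ↥MA.powerset × ↥M.powerset, realEnv (MA ∪ M) (CA ∪ C) a b s(uy, vy) s(uz, vz) (φ p) =
      ⟨⟨(attS (realSBox MA CA a m) (realEnv M C m b s(uy, vy) s(uz, vz)) p).d0.lam + (-(2 * (Fintype.card V : ℤ))), (attS (realSBox MA CA a m) (realEnv M C m b s(uy, vy) s(uz, vz)) p).d0.k1, (attS (realSBox MA CA a m) (realEnv M C m b s(uy, vy) s(uz, vz)) p).d0.k2⟩,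
        ⟨(attS (realSBox MA CA a m) (realEnv M C m b s(uy, vy) s(uz, vz)) p).dy.lam + (-(2 * (Fintype.card V : ℤ))), (attS (realSBox MA CA a m) (realEnv M C m b s(uy, vy) s(uz, vz)) p).dy.k1, (attS (realSBox MA CA a m) (realEnv M C m b s(uy, vy) s(uz, vz)) p).dy.k2⟩,
        ⟨(attS (realSBox MA CA a m) (realEnv M C m b s(uy, vy) s(uz, vz)) p).dz.lam + (-(2 * (Fintype.card V : ℤ))), (attS (realSBox MA CA a m) (realEnv M C m b s(uy, vy) s(uz, vz)) p).dz.k1, (attS (realSBox MA CA a m) (realEnv M C m b s(uy, vy) s(uz, vz)) p).dz.k2⟩,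
        ⟨(attS (realSBox MA CA a m) (realEnv M C m b s(uy, vy) s(uz, vz)) p).dyz.lam + (-(2 * (Fintype.card V : ℤ))), (attS (realSBox MA CA a m) (realEnv M C m b s(uy, vy) s(uz, vz)) p).dyz.k1, (attS (realSBox MA CA a m) (realEnv M C m b s(uy, vy) s(uz, vz)) p).dyz.k2⟩⟩ := by
    rintro ⟨α, β⟩
    have hα : α.1 ⊆ MA := Finset.mem_powerset.1 α.2
    have hX : β.1 ⊆ M := Finset.mem_powerset.1 β.2
    have p0 : β.1 ⊆ insert s(uy, vy) (insert s(uz, vz) M) := hX.trans ((Finset.subset_insert _ _).trans (Finset.subset_insert _ _))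
    have py : insert s(uy, vy) β.1 ⊆ insert s(uy, vy) (insert s(uz, vz) M) := Finset.insert_subset_insert _ (hX.trans (Finset.subset_insert _ _))
    have pz : insert s(uz, vz) β.1 ⊆ insert s(uy, vy) (insert s(uz, vz) M) :=
      (Finset.insert_subset_insert _ hX).trans (Finset.subset_insert _ _)
    have pyz : insert s(uy, vy) (insert s(uz, vz) β.1) ⊆ insert s(uy, vy) (insert s(uz, vz) M) :=
      Finset.insert_subset_insert _ (Finset.insert_subset_insert _ hX)
    have e0 := PDat.eq_of_addLam (scomb_realSDat0 hd hV haF hbA ham hbm hab hMA hCA hM hC hα p0 (rfl : α.1 ∪ β.1 = _))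
    have ey := PDat.eq_of_addLam (scomb_realSDat0 hd hV haF hbA ham hbm hab hMA hCA hM hC hα py (Finset.union_insert _ _ _).symm)
    have ez := PDat.eq_of_addLam (scomb_realSDat0 hd hV haF hbA ham hbm hab hMA hCA hM hC hα pz (Finset.union_insert _ _ _).symm)
    have eyz := PDat.eq_of_addLam (scomb_realSDat0 hd hV haF hbA ham hbm hab hMA hCA hM hC hα pyz
      (by rw [Finset.union_insert, Finset.union_insert]))
    show (⟨realPDat _ _ a b _ _ (α.1 ∪ β.1), realPDat _ _ a b _ _ (insert s(uy, vy) (α.1 ∪ β.1)),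
      realPDat _ _ a b _ _ (insert s(uz, vz) (α.1 ∪ β.1)), realPDat _ _ a b _ _ (insert s(uy, vy) (insert s(uz, vz) (α.1 ∪ β.1)))⟩ : EDat) = _
    rw [e0, ey, ez, eyz]
    rfl
  exact transfer_facts hφ hd' (attS_facts (realSBox MA CA a m) (realEnv M C m b s(uy, vy) s(uz, vz)) (realSBox_thmU hA hMA hCA) h5)

end Transfers

end RootForm

end FK

end Summit.CriticalPhenomena.PercolationContinuityZ3.Theorems

end
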